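import Summits.Ventures.PackingBounds.ThreePointCert.CheckFKSSound

/-!
# Kronecker-substitution checks of the identities `(i')` and `(ii')`

Framing: lottery ticket; floor = certified bounds/negative ranges. Venture `PackingBounds`
(cell `pub-packcert`), three-point SDP family — kernel-checking infrastructure.

`checkI3` / `checkII3S2a/b/c` expand the products `multiplier × Gram expansion` term by term and
push everything through a coefficient trie (≈ 5 ms per term product; at L = 28 step (c) alone is
≈ 8·10⁴ products). Here the converter supplies the residual `ρ` of each identity as data and the
kernel checks (1) `Σ|ρ| ≤ c₀` and (2) the EXACT identity `target − rhs − c₀ − ρ = 0` at the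
Kronecker point — a handful of big-integer products, since the value of a product is the product
of the values (`idCheckI`, `idCheckII`). The comparison polynomials are ghosts built without
`normalize`/`mulN` (`m2G`, `m3G`, `gegRaw`, `aG`, `rhsG`, `qI`, `qII`) with the values of the
originals. This file: programs, ghosts, values and integer values; bounds and the soundness
theorems (`AF3_of_idKS`, `FII3S2_of_idKS`, `card_le_of_cert3KS`) are in `CheckIdKSSound`.
No statement about certificates changes (`card_le_of_cert3KS` has the conclusion of
`card_le_of_cert3S2splitNN`).
-/

noncomputable section

namespace Summit.Ventures.PackingBounds.ThreePointCert

open Literature.Geometry.DiscreteGeometry Literature.Geometry.DiscreteGeometry.PolyCert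
open Literature.Geometry.DiscreteGeometry.PolyCert.SPoly

/-! ### General Kronecker encodings (arbitrary exponent weights) -/

/-- Bit position `a·ia + b·ib + c·ic` of a monomial. -/
def posG (ia ib ic : ℕ) (m : Mono) : ℕ := Nat.add (Nat.mul m.a ia) (Nat.add (Nat.mul m.b ib) (Nat.mul m.c ic))

/-- Positive part of a term list at `(2^ia, 2^ib, 2^ic)`. -/
def encGP (ia ib ic : ℕ) (p : SPoly) : ℕ :=
  p.rec (motive := fun _ => ℕ) 0 (fun mc _ acc =>
    Int.rec (motive := fun _ => ℕ) (fun n => Nat.add acc (Nat.shiftLeft n (posG ia ib ic mc.1))) (fun _ => acc) mc.2)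

/-- Negative part of a term list at `(2^ia, 2^ib, 2^ic)`. -/
def encGN (ia ib ic : ℕ) (p : SPoly) : ℕ :=
  p.rec (motive := fun _ => ℕ) 0 (fun mc _ acc =>
    Int.rec (motive := fun _ => ℕ) (fun _ => acc) (fun n => Nat.add acc (Nat.shiftLeft (Nat.succ n) (posG ia ib ic mc.1))) mc.2)

/-- Value of a term list at `(2^ia, 2^ib, 2^ic)`. -/
def encG (ia ib ic : ℕ) (p : SPoly) : ℤ := Int.subNatNat (encGP ia ib ic p) (encGN ia ib ic p)

/-- `encG` is `evalZ` at `(2^ia, 2^ib, 2^ic)`. -/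
theorem encG_eq (ia ib ic : ℕ) : ∀ p : SPoly, encG ia ib ic p = evalZ p (2 ^ ia) (2 ^ ib) (2 ^ ic)
  | [] => by simp [encG, encGP, encGN]
  | (m, c) :: p => by
    have ih := encG_eq ia ib ic p
    unfold encG at ih ⊢
    rw [Int.subNatNat_eq_coe] at ih ⊢
    have hm : monoEvalZ m (2 ^ ia) (2 ^ ib) (2 ^ ic) = 2 ^ posG ia ib ic m := by
      simp only [monoEvalZ, posG, ← pow_mul, ← pow_add, Nat.add_eq, Nat.mul_eq]
      congr 1; ring
    rw [evalZ_cons, ← ih, hm]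
    cases c with
    | ofNat n =>
      show ((encGP ia ib ic p + n <<< posG ia ib ic m : ℕ) : ℤ) - (encGN ia ib ic p : ℕ) = _
      rw [Nat.shiftLeft_eq]; simp only [Int.ofNat_eq_natCast]; push_cast; ring
    | negSucc n =>
      show ((encGP ia ib ic p : ℕ) : ℤ) - (encGN ia ib ic p + (n + 1) <<< posG ia ib ic m : ℕ) = _
      rw [Nat.shiftLeft_eq, Int.negSucc_eq]; push_cast; ring

/-! ### Ghost multipliers (no `normalize`) -/

/-- `m₂ = g(u)g(v) + g(u)g(t) + g(v)g(t)` without normalisation. -/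
def m2G (p : ℤ) (q : ℕ) : SPoly :=
  mul (gqU p q) (permBAC (gqU p q)) ++ mul (gqU p q) (permCBA (gqU p q)) ++
    mul (permBAC (gqU p q)) (permCBA (gqU p q))

/-- `m₃ = g(u)g(v)g(t)` without normalisation. -/
def m3G (p : ℤ) (q : ℕ) : SPoly := mul (gqU p q) (mul (permBAC (gqU p q)) (permCBA (gqU p q)))

/-- `m2G` has the values of `m2P`. -/
theorem eval_m2G (p : ℤ) (q : ℕ) (u v t : ℝ) : eval (m2G p q) u v t = eval (m2P p q) u v t := by
  rw [m2G, m2P, eval_normalize]; simp only [eval_append, eval_mul, eval_mulN]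

/-- `m3G` has the values of `m3P`. -/
theorem eval_m3G (p : ℤ) (q : ℕ) (u v t : ℝ) : eval (m3G p q) u v t = eval (m3P p q) u v t := by
  rw [m3G, m3P, eval_normalize]; simp only [eval_mul, eval_mulN]

/-- The sums-of-squares side of `(ii')` (mode `sym2`) without `mulN`/`mergeAll`. -/
def rhsG (c : Cert3) (P : CertPolys3) : SPoly :=
  P.E0 ++ mul (gqU c.p c.q) P.E1 ++ permBAC (mul (gqU c.p c.q) P.E1) ++ permCBA (mul (gqU c.p c.q) P.E1) ++
    mul (m2G c.p c.q) P.E2 ++ mul (m3G c.p c.q) P.E3 ++ mul p4 P.E4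

/-- `rhsG` has the values of `rhsII3S2`. -/
theorem eval_rhsG (c : Cert3) (P : CertPolys3) (u v t : ℝ) :
    eval (rhsG c P) u v t = eval (rhsII3S2 c P) u v t := by
  rw [rhsG, rhsII3S2, eval_mergeAll]
  simp only [eval_append, eval_mul, eval_permBAC, eval_permCBA, gE1, eval_mulN, eval_m2G, eval_m3G,
    List.map_cons, List.map_nil, List.sum_cons, List.sum_nil]
  ring

/-- The identity polynomial of `(ii')`: `target − rhs − c₀ − ρ`. -/
def qII (c : Cert3) (P : CertPolys3) (ρ : SPoly) : SPoly :=
  targetII3 c P ++ neg (rhsG c P) ++ neg (C (c.c0 : ℤ)) ++ neg ρ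

/-- Values of `qII`. -/
theorem eval_qII (c : Cert3) (P : CertPolys3) (ρ : SPoly) (u v t : ℝ) :
    eval (qII c P ρ) u v t =
      eval (targetII3 c P) u v t - eval (rhsII3S2 c P) u v t - c.c0 - eval ρ u v t := by
  rw [qII, eval_append, eval_append, eval_append, eval_neg, eval_neg, eval_neg, eval_rhsG, eval_C]
  push_cast; ring

/-! ### Ghost two-point part -/

/-- `gegTwoI` by the same recurrence without normalisation. -/
def gegRaw (n : ℕ) : ℕ → SPoly
  | 0 => C 1
  | 1 => smul (2 * ((n : ℤ) - 2)) U
  | j + 2 => smul (2 * (2 * (j : ℤ) + n)) (mul U (gegRaw n (j + 1))) ++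
      smul (-(4 * ((j : ℤ) + 1) * ((j : ℤ) + n - 2))) (gegRaw n j)

/-- `gegRaw` has the values of `gegTwoI`. -/
theorem eval_gegRaw (n : ℕ) (u v t : ℝ) : ∀ k, eval (gegRaw n k) u v t = eval (gegTwoI n k) u v t
  | 0 => rfl
  | 1 => rfl
  | j + 2 => by
    rw [gegRaw, gegTwoI, eval_normalize, eval_append, eval_append, eval_smul, eval_smul, eval_smul,
      eval_smul, eval_mul, eval_mulN, eval_gegRaw n u v t (j + 1), eval_gegRaw n u v t j]

/-- `Σ_i A_i · M_{k+i} · gegRaw (k+i)` (the two-point part from index `k`). -/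
def aGA (n d : ℕ) : List ℕ → ℕ → SPoly
  | [], _ => []
  | a :: as, k => smul ((a : ℤ) * (Mfac d k : ℤ)) (gegRaw n k) ++ aGA n d as (k + 1)

/-- `aGA A k` has the value `Σ_{i<|A|} A_i M_{k+i} gegTwoI_{k+i}`. -/
theorem eval_aGA (n d : ℕ) (u v t : ℝ) : ∀ (A : List ℕ) (k : ℕ),
    eval (aGA n d A k) u v t =
      ∑ i ∈ Finset.range A.length, ((A.getD i 0 : ℤ) * (Mfac d (k + i) : ℤ) : ℝ) * eval (gegTwoI n (k + i)) u v t
  | [], k => by simp [aGA]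
  | a :: as, k => by
    rw [aGA, eval_append, eval_smul, eval_gegRaw, eval_aGA n d u v t as (k + 1), List.length_cons,
      Finset.sum_range_succ']
    simp only [List.getD_cons_succ, List.getD_cons_zero, add_zero]
    rw [add_comm]
    congr 1
    · exact Finset.sum_congr rfl fun i _ => by rw [show k + 1 + i = k + (i + 1) by ring]
    · push_cast; ring

/-- The ghost two-point part has the values of `APolyG`. -/
theorem eval_aG (n d : ℕ) (A : List ℕ) (u v t : ℝ) : eval (aGA n d A 0) u v t = eval (APolyG n d A) u v t := by
  rw [eval_aGA, APolyG, eval_mergeAll, List.map_map]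
  rw [show (List.map ((fun p => eval p u v t) ∘ fun k => smul ((A.getD k 0 : ℤ) * (Mfac d k : ℤ)) (gegTwoI n k))
      (List.range A.length)).sum = ((List.range A.length).map fun k =>
        (((A.getD k 0 : ℤ) * (Mfac d k : ℤ) : ℤ) : ℝ) * eval (gegTwoI n k) u v t).sum from
      congrArg List.sum (List.map_congr_left fun k _ => by simp only [Function.comp_apply, eval_smul])]
  rw [list_sum_map_range]
  exact Finset.sum_congr rfl fun i _ => by rw [zero_add]; push_cast; ring

/-- The identity polynomial of `(i')`: `target − rhs − c₀₁ − ρ₁` with the ghost two-point part. -/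
def qI (c : Cert3) (P : CertPolys3) (ρ : SPoly) : SPoly :=
  neg (C ((c.DDW : ℤ) + 2 * c.B12 + c.B22) ++ aGA c.n c.d c.A 0 ++ smul 3 (substUU1 P.FP)) ++
    neg (P.EQ0 ++ mul (gqU c.p c.q) P.EQ1) ++ neg (C (c.c01 : ℤ)) ++ neg ρ

/-- Values of `qI`. -/
theorem eval_qI (c : Cert3) (P : CertPolys3) (ρ : SPoly) (u v t : ℝ) :
    eval (qI c P ρ) u v t = eval (targetI3 c P) u v t - eval (rhsI3 c P) u v t - c.c01 - eval ρ u v t := by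
  rw [qI, targetI3, rhsI3, eval_mergeAll]
  simp only [eval_append, eval_neg, eval_C, eval_smul, eval_aG, eval_mul, eval_mulN, List.map_cons,
    List.map_nil, List.sum_cons, List.sum_nil]
  push_cast; ring

/-! ### Kernel programs -/

/-- `gegTwoI n k` at an integer point by the recurrence. -/
def gegZ (n : ℕ) (x : ℤ) : ℕ → ℤ
  | 0 => 1
  | 1 => 2 * ((n : ℤ) - 2) * x
  | j + 2 => 2 * (2 * (j : ℤ) + n) * x * gegZ n x (j + 1) + -(4 * ((j : ℤ) + 1) * ((j : ℤ) + n - 2)) * gegZ n x j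

/-- `aGA A k` at an integer point. -/
def aZ (n d : ℕ) (x : ℤ) : List ℕ → ℕ → ℤ
  | [], _ => 0
  | a :: as, k => (a : ℤ) * (Mfac d k : ℤ) * gegZ n x k + aZ n d x as (k + 1)

/-- `absSum (gegRaw n k)` by the recurrence. -/
def gegAbs (n : ℕ) : ℕ → ℕ
  | 0 => 1
  | 1 => (2 * ((n : ℤ) - 2)).natAbs
  | j + 2 => (2 * (2 * (j : ℤ) + n)).natAbs * gegAbs n (j + 1) + (4 * ((j : ℤ) + 1) * ((j : ℤ) + n - 2)).natAbs * gegAbs n j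

/-- `absSum (aGA A k)`. -/
def aAbs (n d : ℕ) : List ℕ → ℕ → ℕ
  | [], _ => 0
  | a :: as, k => a * Mfac d k * gegAbs n k + aAbs n d as (k + 1)

/-- Coefficient bound of `qII`. -/
def bndII (c : Cert3) (P : CertPolys3) (ρ : SPoly) : ℕ :=
  c.B22 + absSum P.FP + (absSum P.E0 + 3 * (absSum (gqU c.p c.q) * absSum P.E1) +
    absSum (m2G c.p c.q) * absSum P.E2 + absSum (m3G c.p c.q) * absSum P.E3 + absSum p4 * absSum P.E4) +
    c.c0 + absSum ρ

/-- Coefficient bound of `qI`. -/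
def bndI (c : Cert3) (P : CertPolys3) (ρ : SPoly) : ℕ :=
  ((c.DDW : ℤ) + 2 * c.B12 + c.B22).natAbs + aAbs c.n c.d c.A 0 + 3 * absSum P.FP +
    (absSum P.EQ0 + absSum (gqU c.p c.q) * absSum P.EQ1) + c.c01 + absSum ρ

/-- Value of `qII` at `(2^ia, 2^ib, 2^ic)`. -/
def valII (ia ib ic : ℕ) (c : Cert3) (P : CertPolys3) (ρ : SPoly) : ℤ :=
  -((c.B22 : ℤ) + encG ia ib ic P.FP) -
    (encG ia ib ic P.E0 + encG ia ib ic (gqU c.p c.q) * encG ia ib ic P.E1 +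
      encG ib ia ic (gqU c.p c.q) * encG ib ia ic P.E1 + encG ic ib ia (gqU c.p c.q) * encG ic ib ia P.E1 +
      encG ia ib ic (m2G c.p c.q) * encG ia ib ic P.E2 + encG ia ib ic (m3G c.p c.q) * encG ia ib ic P.E3 +
      encG ia ib ic p4 * encG ia ib ic P.E4) -
    c.c0 - encG ia ib ic ρ

/-- Value of `qI` at `(2^ia, 2^ib, 2^ic)`. -/
def valI (ia ib ic : ℕ) (c : Cert3) (P : CertPolys3) (ρ : SPoly) : ℤ :=
  -(((c.DDW : ℤ) + 2 * c.B12 + c.B22) + aZ c.n c.d (2 ^ ia) c.A 0 + 3 * encG ia ia 0 P.FP) -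
    (encG ia ib ic P.EQ0 + encG ia ib ic (gqU c.p c.q) * encG ia ib ic P.EQ1) - c.c01 - encG ia ib ic ρ

/-- **Kronecker-substitution check of `(ii')`** (mode `sym2`): exponent side conditions, `Σ|ρ| ≤ c₀`,
the coefficient bound and the exact identity at `(2^w, 2^{wD}, 2^{wD²})`. -/
def idCheckII (w D : ℕ) (c : Cert3) (P : CertPolys3) (ρ : SPoly) : Bool :=
  decide (2 ≤ D) && boxOK D P.FP && boxOK D P.E0 && boxOK (D - 2) P.E1 && boxOK (D - 2) P.E2 &&
    boxOK (D - 2) P.E3 && boxOK (D - 2) P.E4 && boxOK D ρ && decide (absSum ρ ≤ c.c0) &&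
    decide (2 * bndII c P ρ < 2 ^ w) && decide (valII w (w * D) (w * D * D) c P ρ = 0)

/-- **Kronecker-substitution check of `(i')`**. -/
def idCheckI (w D : ℕ) (c : Cert3) (P : CertPolys3) (ρ : SPoly) : Bool :=
  decide (2 ≤ D) && decide (c.A.length ≤ D) && boxOK D (substUU1 P.FP) && boxOK D P.EQ0 &&
    boxOK (D - 2) P.EQ1 && boxOK D ρ && decide (absSum ρ ≤ c.c01) &&
    decide (2 * bndI c P ρ < 2 ^ w) && decide (valI w (w * D) (w * D * D) c P ρ = 0)

/-! ### Integer values of the ghosts -/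

/-- `gegZ` is the integer value of `gegRaw`. -/
theorem evalZ_gegRaw (n : ℕ) (x y z : ℤ) : ∀ k, evalZ (gegRaw n k) x y z = gegZ n x k
  | 0 => by simp [gegRaw, gegZ, C, evalZ, monoEvalZ]
  | 1 => by rw [gegRaw, gegZ, evalZ_smul]; simp [U, evalZ, monoEvalZ]
  | j + 2 => by
    have hU : evalZ U x y z = x := by simp [U, evalZ, monoEvalZ]
    rw [gegRaw, gegZ, evalZ_append, evalZ_smul, evalZ_smul, evalZ_mul, hU, evalZ_gegRaw n x y z (j + 1),
      evalZ_gegRaw n x y z j]; ring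

/-- `aZ` is the integer value of `aGA`. -/
theorem evalZ_aGA (n d : ℕ) (x y z : ℤ) : ∀ (A : List ℕ) (k : ℕ), evalZ (aGA n d A k) x y z = aZ n d x A k
  | [], k => by simp [aGA, aZ]
  | a :: as, k => by rw [aGA, aZ, evalZ_append, evalZ_smul, evalZ_gegRaw, evalZ_aGA n d x y z as (k + 1)]

/-- `evalZ` of `substUU1`: the value at `(x, x, 1)`. -/
theorem evalZ_substUU1 (p : SPoly) (x y z : ℤ) : evalZ (substUU1 p) x y z = evalZ p x x 1 := by
  have h : ((evalZ (substUU1 p) x y z : ℤ) : ℝ) = ((evalZ p x x 1 : ℤ) : ℝ) := by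
    rw [cast_evalZ, cast_evalZ, eval_substUU1]; push_cast; rfl
  exact_mod_cast h

/-- `evalZ (C a) = a`. -/
theorem evalZ_C (a x y z : ℤ) : evalZ (C a) x y z = a := by simp [C, evalZ, monoEvalZ]

/-- `valII` is the value of `qII` at the Kronecker point. -/
theorem valII_eq (w D : ℕ) (c : Cert3) (P : CertPolys3) (ρ : SPoly) :
    valII w (w * D) (w * D * D) c P ρ = evalZ (qII c P ρ) (2 ^ w) (2 ^ (w * D)) (2 ^ (w * D * D)) := by
  simp only [valII, qII, targetII3, rhsG, evalZ_append, evalZ_neg, evalZ_mul, evalZ_permBAC, evalZ_permCBA,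
    evalZ_C, encG_eq]
  ring

/-- `valI` is the value of `qI` at the Kronecker point. -/
theorem valI_eq (w D : ℕ) (c : Cert3) (P : CertPolys3) (ρ : SPoly) :
    valI w (w * D) (w * D * D) c P ρ = evalZ (qI c P ρ) (2 ^ w) (2 ^ (w * D)) (2 ^ (w * D * D)) := by
  simp only [valI, qI, evalZ_append, evalZ_neg, evalZ_mul, evalZ_smul, evalZ_C, encG_eq, evalZ_aGA,
    evalZ_substUU1, pow_zero]
  ring

/-! ### Coefficient sums of the ghosts -/

/-- `absSum (C a) = |a|`. -/
theorem absSum_C (a : ℤ) : absSum (C a) = a.natAbs := by simp [C, absSum]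

/-- `substUU1` preserves `absSum`. -/
theorem absSum_substUU1 (p : SPoly) : absSum (substUU1 p) = absSum p := by
  simp [substUU1, absSum, List.map_map, Function.comp_def]

/-- `absSum (gegRaw n k) = gegAbs n k`. -/
theorem absSum_gegRaw (n : ℕ) : ∀ k, absSum (gegRaw n k) = gegAbs n k
  | 0 => rfl
  | 1 => by rw [gegRaw, gegAbs, absSum_smul, show absSum U = 1 from rfl, mul_one]
  | j + 2 => by
    have hU : absSum U = 1 := rfl
    rw [gegRaw, gegAbs, absSum_append, absSum_smul, absSum_smul, absSum_mul, hU, one_mul,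
      absSum_gegRaw n (j + 1), absSum_gegRaw n j, Int.natAbs_neg]

/-- `absSum (aGA n d A k) = aAbs n d A k`. -/
theorem absSum_aGA (n d : ℕ) : ∀ (A : List ℕ) (k : ℕ), absSum (aGA n d A k) = aAbs n d A k
  | [], k => rfl
  | a :: as, k => by
    rw [aGA, aAbs, absSum_append, absSum_smul, absSum_gegRaw, absSum_aGA n d as (k + 1), Int.natAbs_mul,
      Int.natAbs_natCast, Int.natAbs_natCast]

end Summit.Ventures.PackingBounds.ThreePointCert

end
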